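import Mathlib
import Summits.KontsevichZagierPeriods.Zeta5Search.Families.GapCoordinates
import HarnessLib

/-!
# ζ(5) search — Families: products of powers of point differences on the simplex — sector combinatorics

HONEST FRAMING: systematic search; no irrationality claim unless certified.  This file contains NO statement about
zeta values.  It is file 3 of the ANALYTIC half of Brown's convergence criterion [Brown2016, §2.4, Lemma 3.6,
Def. 5.1] for the generalised cellular integrals of `Families/CellularIntegral.lean` (seat P2).

Objects.  An `EdgeFamily ℓ ι` is a finite family of edges `{lo i < hi i} ⊆ {0,…,ℓ+1}` between the finite marked
points of the simplex `0 = z₀ < t₁ < ⋯ < t_ℓ < 1 = z_{ℓ+1}`; with real exponents `c : ι → ℝ` it defines the function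
`powProd E c t = ∏_i (pt t (hi i) − pt t (lo i))^{c_i}` — every generalised cellular integrand `f_σ(a,b) ω_σ` in
simplicial coordinates is of this form (file 4).  The `span` of an edge is the set of gaps `lo ≤ w < hi` it covers,
so that its length is the sum of those gaps (`len_eq_sum_gap`).

Block functional.  `blockSum E c L = |L| + Σ_{i : span i ⊆ L} c_i` for a set `L` of gaps; the CRITERION `Crit E c`
asks `0 < blockSum` on every run of `1 ≤ q − p ≤ ℓ` consecutive gaps `[p,q)` (= a block of `2,…,ℓ+1 = n−2`
consecutive finite points collapsing: Brown's divisors at finite distance).  `blockSum_pos_of_crit`: the criterion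
propagates from runs to ALL gap sets of size `≤ ℓ` (a non-run splits at a missing gap into two smaller sets, and an
edge span, being an interval, lies on one side).  The Hepp-sector bounds are in `Families/SectorBounds.lean`.
Standard axioms only.
-/

noncomputable section

open MeasureTheory Set Finset

namespace Summit.KontsevichZagierPeriods.Zeta5Search.Families.Cellular

variable {ℓ : ℕ} {ι : Type*}

/-- A finite family of edges `{lo i, hi i}`, `lo i < hi i ≤ ℓ + 1`, between the finite marked points. -/
structure EdgeFamily (ℓ : ℕ) (ι : Type*) where
  /-- lower endpoint (index of a finite marked point) -/
  lo : ι → ℕ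
  /-- upper endpoint -/
  hi : ι → ℕ
  lo_lt_hi : ∀ i, lo i < hi i
  hi_le : ∀ i, hi i ≤ ℓ + 1

variable (E : EdgeFamily ℓ ι)

namespace EdgeFamily

/-- The gaps covered by edge `i`: `lo i ≤ w < hi i`. -/
def span (i : ι) : Finset (Fin (ℓ + 1)) := univ.filter fun w => E.lo i ≤ w.val ∧ w.val < E.hi i

/-- Membership in the span. -/
@[simp] theorem mem_span (i : ι) (w : Fin (ℓ + 1)) : w ∈ E.span i ↔ E.lo i ≤ w.val ∧ w.val < E.hi i := by
  simp [span]

/-- The span is nonempty. -/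
theorem span_nonempty (i : ι) : (E.span i).Nonempty :=
  ⟨⟨E.lo i, by have := E.lo_lt_hi i; have := E.hi_le i; omega⟩, by simp [E.lo_lt_hi i]⟩

/-- The length of edge `i` at the point `t`. -/
def len (t : Fin ℓ → ℝ) (i : ι) : ℝ := pt t (E.hi i) - pt t (E.lo i)

/-- The product of powers `∏_i len_i ^ c_i`. -/
def powProd [Fintype ι] (c : ι → ℝ) (t : Fin ℓ → ℝ) : ℝ := ∏ i, E.len t i ^ c i

/-- The length of an edge is the sum of the gaps it spans. -/
theorem len_eq_sum_gap (t : Fin ℓ → ℝ) (i : ι) : E.len t i = ∑ w ∈ E.span i, gapN t w := by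
  unfold len
  rw [pt_sub_pt_eq_sum_gapN t (E.lo_lt_hi i).le, span, Finset.sum_filter]
  rw [Fin.sum_univ_eq_sum_range (fun w : ℕ => if E.lo i ≤ w ∧ w < E.hi i then gapN t w else 0) (ℓ + 1),
    ← Finset.sum_filter]
  congr 1
  ext w
  simp only [Finset.mem_Ico, Finset.mem_filter, Finset.mem_range]
  have := E.hi_le i
  omega

/-- Edge lengths are positive on the open simplex. -/
theorem len_pos {t : Fin ℓ → ℝ} (ht : t ∈ openSimplex ℓ) (i : ι) : 0 < E.len t i := by
  rw [len_eq_sum_gap]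
  exact Finset.sum_pos (fun w _ => (mem_openSimplex_iff_gapN t).1 ht w) (E.span_nonempty i)

/-- `powProd` is positive on the open simplex. -/
theorem powProd_pos [Fintype ι] (c : ι → ℝ) {t : Fin ℓ → ℝ} (ht : t ∈ openSimplex ℓ) : 0 < E.powProd c t :=
  Finset.prod_pos fun i _ => Real.rpow_pos_of_pos (E.len_pos ht i) _

/-- `powProd` is measurable. -/
theorem measurable_powProd [Fintype ι] (c : ι → ℝ) : Measurable (E.powProd c) := by
  unfold powProd len
  exact Finset.measurable_prod _ fun i _ =>
    (((continuous_pt _).sub (continuous_pt _)).measurable).pow_const _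

/-! ### Block functional and the criterion -/

/-- `blockSum E c L = |L| + Σ_{i : span i ⊆ L} c_i`. -/
def blockSum [Fintype ι] (c : ι → ℝ) (L : Finset (Fin (ℓ + 1))) : ℝ :=
  (L.card : ℝ) + ∑ i ∈ univ.filter (fun i => E.span i ⊆ L), c i

end EdgeFamily

/-- The run of gaps `p ≤ w < q`. -/
def gapRun (ℓ p q : ℕ) : Finset (Fin (ℓ + 1)) := univ.filter fun w => p ≤ w.val ∧ w.val < q

/-- Membership in a run. -/
@[simp] theorem mem_gapRun (p q : ℕ) (w : Fin (ℓ + 1)) : w ∈ gapRun ℓ p q ↔ p ≤ w.val ∧ w.val < q := by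
  simp [gapRun]

/-- A run of gaps below `ℓ+1` has `q − p` elements. -/
theorem card_gapRun (p q : ℕ) (hq : q ≤ ℓ + 1) : (gapRun ℓ p q).card = q - p := by
  rw [gapRun]
  have : (univ.filter fun w : Fin (ℓ + 1) => p ≤ w.val ∧ w.val < q) =
      (Finset.Ico p q).attachFin (fun w hw => by have := (Finset.mem_Ico.1 hw).2; omega) := by
    ext w; simp
  rw [this, Finset.card_attachFin, Nat.card_Ico]

namespace EdgeFamily

/-- An edge span lies in the run `[p, q)` iff `p ≤ lo` and `hi ≤ q`. -/
theorem span_subset_gapRun_iff (i : ι) (p q : ℕ) : E.span i ⊆ gapRun ℓ p q ↔ p ≤ E.lo i ∧ E.hi i ≤ q := by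
  have h1 := E.lo_lt_hi i
  have h2 := E.hi_le i
  constructor
  · intro h
    have hlo := (mem_gapRun p q _).1 (h ((E.mem_span i ⟨E.lo i, by omega⟩).2 ⟨le_rfl, h1⟩))
    have hhi := (mem_gapRun p q _).1 (h ((E.mem_span i ⟨E.hi i - 1, by omega⟩).2 ⟨by simp only; omega, by
      simp only; omega⟩))
    simp only at hlo hhi
    omega
  · rintro ⟨hp, hq⟩ w hw
    rw [mem_gapRun]
    have := (E.mem_span i w).1 hw
    omega

/-- The CRITERION: positive block functional on every run of `1,…,ℓ` consecutive gaps (`p < q ≤ ℓ+1`, `q − p ≤ ℓ`),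
i.e. on every block of `2,…,n−2` consecutive finite marked points. [Brown2016, §2.4, Def. 5.1 (analytic form)] -/
def Crit [Fintype ι] (c : ι → ℝ) : Prop :=
  ∀ p q : ℕ, p < q → q ≤ ℓ + 1 → q - p ≤ ℓ → 0 < E.blockSum c (gapRun ℓ p q)

/-- An edge span inside `L₁ ∪ L₂`, with `L₁` below a missing gap `w₀` and `L₂` above it, lies in one of them. -/
theorem span_subset_split (L : Finset (Fin (ℓ + 1))) (w0 : Fin (ℓ + 1)) (hw0 : w0 ∉ L) (i : ι) :
    E.span i ⊆ L ↔ E.span i ⊆ L.filter (fun w => w.val < w0.val) ∨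
      E.span i ⊆ L.filter (fun w => ¬ w.val < w0.val) := by
  constructor
  · intro h
    by_cases hlo : E.hi i ≤ w0.val
    · left
      intro w hw
      rw [Finset.mem_filter]
      exact ⟨h hw, by have := (E.mem_span i w).1 hw; omega⟩
    · right
      intro w hw
      rw [Finset.mem_filter]
      refine ⟨h hw, ?_⟩
      have hw' := (E.mem_span i w).1 hw
      intro hlt
      -- then `w0` itself lies in the span, hence in `L`
      have : w0 ∈ E.span i := by
        rw [E.mem_span]; omega
      exact hw0 (h this)
  · rintro (h | h)
    · exact h.trans (Finset.filter_subset _ _)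
    · exact h.trans (Finset.filter_subset _ _)

/-- **Propagation of the criterion**: positive block functional on every nonempty set of at most `ℓ` gaps. -/
theorem blockSum_pos_of_crit [Fintype ι] {c : ι → ℝ} (hc : E.Crit c) :
    ∀ n : ℕ, ∀ L : Finset (Fin (ℓ + 1)), L.card = n → L.Nonempty → L.card ≤ ℓ → 0 < E.blockSum c L := by
  classical
  intro n
  induction n using Nat.strong_induction_on with
  | _ n ih =>
    intro L hLn hne hcard
    set p : ℕ := (L.min' hne).val with hp
    set q : ℕ := (L.max' hne).val + 1 with hq
    have hsub : L ⊆ gapRun ℓ p q := by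
      intro w hw
      rw [mem_gapRun]
      exact ⟨Fin.le_def.1 (L.min'_le w hw), Nat.lt_succ_of_le (Fin.le_def.1 (L.le_max' w hw))⟩
    by_cases hrun : gapRun ℓ p q ⊆ L
    · -- `L` is a run
      have hL : L = gapRun ℓ p q := Finset.Subset.antisymm hsub hrun
      have hpq : p < q := by
        have := Fin.le_def.1 (L.min'_le _ (L.max'_mem hne)); omega
      have hq' : q ≤ ℓ + 1 := by have := (L.max' hne).isLt; omega
      have hcard' : q - p ≤ ℓ := by
        rw [← card_gapRun p q hq', ← hL]; exact hcard
      rw [hL]; exact hc p q hpq hq' hcard'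
    · -- split `L` at a missing gap `w0`
      obtain ⟨w0, hw0r, hw0L⟩ := Finset.not_subset.1 hrun
      set L1 := L.filter (fun w => w.val < w0.val) with hL1
      set L2 := L.filter (fun w => ¬ w.val < w0.val) with hL2
      have hmin1 : L.min' hne ∈ L1 := by
        rw [hL1, Finset.mem_filter]
        refine ⟨L.min'_mem hne, ?_⟩
        have h1 : p ≤ w0.val := ((mem_gapRun p q w0).1 hw0r).1
        have h2 : (L.min' hne).val ≠ w0.val := fun h => hw0L ((Fin.ext h) ▸ L.min'_mem hne)
        omega
      have hmax2 : L.max' hne ∈ L2 := by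
        rw [hL2, Finset.mem_filter]
        refine ⟨L.max'_mem hne, ?_⟩
        have h1 : w0.val < q := ((mem_gapRun p q w0).1 hw0r).2
        omega
      have hne1 : L1.Nonempty := ⟨_, hmin1⟩
      have hne2 : L2.Nonempty := ⟨_, hmax2⟩
      have hdisj : Disjoint L1 L2 := by
        rw [hL1, hL2]; exact Finset.disjoint_filter_filter_not L L fun w => w.val < w0.val
      have hunion : L1 ∪ L2 = L := by rw [hL1, hL2]; exact Finset.filter_union_filter_not_eq _ L
      have hcardsum : L1.card + L2.card = L.card := by rw [← Finset.card_union_of_disjoint hdisj, hunion]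
      have hlt1 : L1.card < n := by have := hne2.card_pos; omega
      have hlt2 : L2.card < n := by have := hne1.card_pos; omega
      have h1 := ih L1.card hlt1 L1 rfl hne1 (by omega)
      have h2 := ih L2.card hlt2 L2 rfl hne2 (by omega)
      -- `blockSum L = blockSum L1 + blockSum L2`
      have hsplit : E.blockSum c L = E.blockSum c L1 + E.blockSum c L2 := by
        unfold blockSum
        have hfilt : (univ.filter fun i => E.span i ⊆ L) =
            (univ.filter fun i => E.span i ⊆ L1) ∪ (univ.filter fun i => E.span i ⊆ L2) := by
          ext i
          simp only [Finset.mem_filter, Finset.mem_univ, true_and, Finset.mem_union]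
          exact E.span_subset_split L w0 hw0L i
        have hdisj' : Disjoint (univ.filter fun i => E.span i ⊆ L1) (univ.filter fun i => E.span i ⊆ L2) := by
          rw [Finset.disjoint_filter]
          intro i _ h1' h2'
          obtain ⟨w, hw⟩ := E.span_nonempty i
          exact Finset.disjoint_left.1 hdisj (h1' hw) (h2' hw)
        rw [hfilt, Finset.sum_union hdisj', ← hcardsum]
        push_cast
        ring
      rw [hsplit]
      exact add_pos h1 h2

/-- The criterion on all nonempty gap sets of size `≤ ℓ`. -/
theorem blockSum_pos_of_crit' [Fintype ι] {c : ι → ℝ} (hc : E.Crit c) (L : Finset (Fin (ℓ + 1))) (hne : L.Nonempty)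
    (hcard : L.card ≤ ℓ) : 0 < E.blockSum c L :=
  E.blockSum_pos_of_crit hc L.card L rfl hne hcard

end EdgeFamily

end Summit.KontsevichZagierPeriods.Zeta5Search.Families.Cellular
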